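import Summits.QuantumFields.BalabanUV.T4Continuum.Spine.NE1p.DressedSmallFieldGeometryFaces

/-!
# T⁴ programme, spine estimate NE1′ (node O3b/H2) — THE GENERATION-27 ϱ-FREE INDUCTION END ON THE POLYMER GEOMETRY OF RECORD AND ON
# THE TORUS: N0m v1.1's `attachedPart_locE_le_of_printClause_four` and its twice-undressed-plus-twice-attached companion over a
# `B13Resummation.Geometry` bundle and at the CONSTRUCTED torus geometry `tgeometry 4 N`, clauses located as numerals (crew row S26)

Cell `pub-balaban`, sub-cell `t4`, BINDER-OWNERS row NE1′ (owner lineage t4-ne1p-p1); crew seat `b2b-balaban-t4-ne1p-formalise-leaf-05`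
(LEAF PROVER 05, generation 9), crew row S26 (typer R-T104 (ii); owner g27 «GO — NOT MINE»).  ADDITIVE — imports S24
`Spine/NE1p/DressedSmallFieldGeometryFaces` (p221652; ⇒ N0o p221125 ⇒ N0m `DressedSmallFieldInduction` v1.1 p223427 ⇒ N0j, pv22
`TreeLengthTorusGeometry`) ONLY; THEOREMS ONLY (+ two `example`s; 0 `def`, 0 `def … : Prop`); nothing of N0m ∕ N0o ∕ S24 ∕ S25 restated.

WHY THIS FILE.  After N0o, S24 and S25 every small-field END of the owner's generation-26 modules that carries a geometry socket has a
form over a `B13Resummation.Geometry` and one with NO geometry hypothesis on the tree's CONSTRUCTED torus geometry (R-T102 (i)).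
N0m v1.1 §4 adds ONE more such END, `attachedPart_locE_le_of_printClause_four` — N0m §2's induction face at the pencil radius
`ϱ⋆ := max 2 (A₀/A₁)` with `hϱ` ∕ `hϱA` ∕ `hsmall` ELIMINATED in favour of a live slope `0 < A₁ ≤ A₀` and the clause
`4·A₀·(e^{b+1}·K₀·ν·c₁) ≤ 1` («ε₁ sufficiently small» at the UNDRESSED constant with a factor-4 room — the owner's reading (R12) of
[Balaban1988RGII] p. 21, TYPE) — and its docstring names, without typing it, the companion for EVERY live slope `0 < A₁` under the
clause at twice the undressed plus twice the attached constant (`pencilClause_of_two_two`).  Both display the geometry ∕ sign sockets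
(= binder group (B4)).  THIS FILE wires them, nothing else — the S24 ∕ S25 pattern verbatim:
* §1 over ONE `G : B13Resummation.Geometry D Cube` (footprint `G.cubes X₀`, `dX := D.dj X₀`, print's (2.27) constant `c = 5`,
  `b = 5·r₁`), EXPLICIT `[DecidableEq D.Dom] [DecidableRel G.ι]`: `attachedPart_locE_le_of_printClause_four_of_geometry` — ONE `exact`
  of the v1.1 END; `attachedPart_locE_le_of_twoTwoClause_of_geometry` — N0m §2 `attachedPart_locE_le` at `ϱ⋆` with `hϱ` ∕ `hϱA` ∕
  `hsmall` supplied BY NAME by v1.1's `two_le_pencilRadius` ∕ `intercept_le_pencilRadius_mul` ∕ `pencilClause_of_two_two` under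
  `h22 : (2·A₀ + 2·A₁)·(e^{5r₁+1}·G.K₀·G.ν·G.c₁) ≤ 1` — NO `hle` (typed once so that a consumer needs no case split on `A₁ ≤ A₀`).
* §2 at `tgeometry 4 N` (pv22; 𝐃_{k+1} = `tsys 4 N`, d_{k+1} = `torusTreeLen`, incompatibility `TTouch`; all fields PROVED there),
  constants LOCATED AS NUMERALS as in S24 ∕ S25 §2 (N0o `torus_consts` + S24 `K₀_four`: ν = 9, κ₀ = 64·log 162, c₁ = 64,
  K₀ = `B12TreeDecay.K₀ 64 8`): `attachedPart_locE_le_of_printClause_four_torus`, `attachedPart_locE_le_of_twoTwoClause_torus` — NO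
  geometry hypothesis, NO radius binder; conclusion LITERALLY the right-hand side of S25's `attachedPart_locE_le_torus`.
* §3 two `example`s (one currency, in kernel): (E1) under `A₁ ≤ A₀` the print-clause torus face FOLLOWS from the twice-two torus face
  (`h4 ⇒ h22`); (E2) the print-clause torus face IS N0o `attachedPart_locE_le_geom` at `ϱ⋆` on `tgeometry 4 N` with `hϱ` ∕ `hϱA` ∕
  `hsmall` from v1.1's §4 arithmetic BY NAME — S26 asserts NO new inequality.
After this file: every small-field END with a geometry socket, INCLUDING the generation-27 ϱ-free END, has a form on pv22's carrier.
v1.1 (same crew seat, generation 10; APPEND-ONLY §4, v1's four theorems and two `example`s byte-identical).  The owner's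
N0m v1.2 (p224750, §4b «the SHARP room is 3») adds ONE more bare END with the same thirteen geometry ∕ sign sockets,
`attachedPart_locE_le_of_printClause_three` (`h4` replaced by `h3 : 3·A₀·(e^{b+1}K₀νc₁) ≤ 1`, attained at `A₁ = A₀`); §4 wires it
exactly as §1∕§2 wire the factor-4 END — `attachedPart_locE_le_of_printClause_three_of_geometry` (ONE `exact` over `G`, explicit
instances, `c = 5`, `b = 5·r₁`) and `attachedPart_locE_le_of_printClause_three_torus` (at `tgeometry 4 N`, NO geometry hypothesis,
NO radius binder, clause `3·A₀·(e^{5r₁+1}·K₀(64,8)·9·64) ≤ 1`, conclusion LITERALLY §2's right-hand side) — plus ONE `example`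
(E3, one currency in kernel): the v1 factor-4 torus face FOLLOWS from the factor-3 torus face (`h4 ⇒ h3`, linear arithmetic);
S26 v1.1 asserts NO new inequality; imports unchanged.
WHAT STAYS DISPLAYED (binders, by name; NOTHING instantiated on Bałaban's densities): (E1)∕(E2) `hhol` ∕ `hm` along the TABLE-STRENGTH
pencil on the ball of radius `ϱ⋆` with a strength-free majorant; (B3) `hL3` — ONE (2.38)-SHAPE inequality, AFFINE `A₀ + ϱ⋆·A₁` (= GAPS
G-ne9p2-5 read with its printed E₀-linearity, shared with NE9; a BINDER, never `[cite:`-tagged); `hA₀`, `hA₁ : 0 < A₁` (`hle : A₁ ≤ A₀`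
for the print-clause faces), `hr₁`, and the two located clauses «κ large» `r₁ + 2·(64·log 162) + 2 ≤ R` and «ε₁ small» in one of the
SHAPES `4·A₀·E ≤ 1` ∕ `(2·A₀ + 2·A₁)·E ≤ 1`, `E = e^{5r₁+1}·K₀(64,8)·9·64` ((B5): the SHAPES, the factor `4` and `2·A₀ + 2·A₁` are the
owner's v1.1 arithmetic consumed BY NAME, not re-derived; their standing against print's NUMBERS is untouched).  (B4) is discharged BY
NAME on pv22's CONSTRUCTED torus geometry; the identification of `tsys 4 N` ∕ `torusTreeLen` with Bałaban's 𝐃_{k+1} ∕ d_{k+1} is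
pv22's READING (DIVERGENCE D-pv22.3), not asserted here — a statement about typed SHAPES; no wall item moves; R-t4r2-Q2 NOT met thereby.
HONEST FRAMING.  Kernel bookkeeping; printed loci ([Balaban1988RGII] (2.11) p. 14, (1.26) p. 8, (2.27) ∕ (2.30) p. 18, (2.38) p. 20,
p. 21; [Balaban1987RGI] p. 251, p. 257) are TYPE ∕ CONTEXT through the imported [cite]-tagged Literature modules, re-asserted nowhere;
ABSOLUTE RULE honoured ([folklore] kernel lemmas only).  NE1′ ⇐ the named binders — NOT printed, NOT proved; 0 leaves instantiated on
Bałaban's densities; spine PROVED 0∕9; count 9 unchanged.  Rung (B)+1 on ONE finite four-torus — NOT infinite volume, NOT a mass gap,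
NOT OS on ℝ⁴, NOT Clay.  HONEST DEPENDENCY: continuum YM on T⁴ ⇐ BetaPertH ∧ nine spine estimates (0/9 proved); BetaPertH ⇐ (D1) ∧
(D4) ∧ CAP+tail; G-an2-4 gates asym, D1 and NE2/3/4.
-/

noncomputable section
namespace Summit.QuantumFields.BalabanUV.T4Continuum.NE1p.DressedSmallFieldInductionFaces
open Metric Set Complex
open Literature.MathematicalPhysics.QuantumFieldTheory.Balaban1983to89 (LocDomainSys)
open Literature.MathematicalPhysics.QuantumFieldTheory.Balaban1983to89.B13Resummation (locE Geometry)
open Literature.MathematicalPhysics.QuantumFieldTheory.Balaban1983to89.TreeLengthTorus (tsys torusTreeLen)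
open Literature.MathematicalPhysics.QuantumFieldTheory.Balaban1983to89.TreeLengthTorusGeometry (TTouch tgeometry)
open Literature.MathematicalPhysics.QuantumFieldTheory.Balaban1983to89.B12TreeDecay (K₀ K₀_pos)
open Summit.QuantumFields.BalabanUV.T4Continuum.NE1p.DressedSmallFieldInduction (attachedPart_locE_le
  attachedPart_locE_le_of_printClause_four two_le_pencilRadius intercept_le_pencilRadius_mul pencilClause_of_two_two
  pencilClause_of_printClause_four)
open Summit.QuantumFields.BalabanUV.T4Continuum.NE1p.DressedSmallFieldGeometry (attachedPart_locE_le_geom torus_consts)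
open Summit.QuantumFields.BalabanUV.T4Continuum.NE1p.DressedSmallFieldGeometryFaces (K₀_four)

/-! ## §1 THE ϱ-FREE INDUCTION ENDs OVER A `B13Resummation.Geometry` BUNDLE — geometry ∕ sign sockets ↦ one bundle -/
section OfGeometry
variable {D : LocDomainSys} {Cube : Type} [DecidableEq Cube] [DecidableEq D.Dom] (G : Geometry D Cube) [DecidableRel G.ι]

/-- **THE ATTACHED PART UNDER PRINT'S CLAUSE WITH A FACTOR-4 ROOM, OVER A POLYMER GEOMETRY** (kernel; N0m v1.1
`attachedPart_locE_le_of_printClause_four` BY NAME, geometry ∕ sign sockets fed from `G` at the footprint `G.cubes X₀`, `c = 5`,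
`b = 5·r₁`): live slope `0 < A₁ ≤ A₀`, «κ large» `hrate`, «ε₁ small at the undressed constant with a factor-4 room» `h4`, (E1)∕(E2) on
the ball of radius `ϱ⋆ = max 2 (A₀/A₁)`, AFFINE (2.38)-majorant `hL3` (a BINDER = (B3)) ⇒ `≤ 4·(e·G.ν·G.c₁·G.K₀²)·A₁·e^{−r₁ d(X₀)}`.
[folklore] -/
theorem attachedPart_locE_le_of_printClause_four_of_geometry {m : D.Dom → ℝ} {act : ℂ → D.Dom → ℂ} {A₀ A₁ R r₁ : ℝ}
    (X₀ : D.Dom) (hA₀ : 0 ≤ A₀) (hA₁ : 0 < A₁) (hle : A₁ ≤ A₀) (hr₁ : 0 ≤ r₁) (hrate : r₁ + 2 * G.κ₀ + 2 ≤ R)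
    (h4 : 4 * A₀ * (Real.exp (5 * r₁ + 1) * G.K₀ * G.ν * G.c₁) ≤ 1)
    (hhol : ∀ Z, G.cubes Z ⊆ G.cubes X₀ → DifferentiableOn ℂ (fun s => act s Z) (ball (0 : ℂ) (max 2 (A₀ / A₁))))
    (hm : ∀ s ∈ ball (0 : ℂ) (max 2 (A₀ / A₁)), ∀ Z, G.cubes Z ⊆ G.cubes X₀ → ‖act s Z‖ ≤ m Z)
    (hL3 : ∀ Z, G.cubes Z ⊆ G.cubes X₀ → m Z ≤ (A₀ + max 2 (A₀ / A₁) * A₁) * Real.exp (-(R * D.dj Z))) :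
    ‖locE G.ι G.cubes (act 1) (G.cubes X₀) - locE G.ι G.cubes (act 0) (G.cubes X₀)‖ ≤
      4 * (Real.exp 1 * G.ν * G.c₁ * G.K₀ ^ 2) * A₁ * Real.exp (-(r₁ * D.dj X₀)) := by
  haveI : Std.Refl G.ι := ⟨G.ι_refl⟩
  haveI : Std.Symm G.ι := ⟨G.ι_symm⟩
  exact attachedPart_locE_le_of_printClause_four G.ι (c := 5) (b := 5 * r₁) G.loc G.reach_le D.dj_nonneg hA₀ hA₁ hle
    G.K₀_nonneg G.c₁_nonneg G.ν_nonneg G.κ₀_nonneg hr₁ (by norm_num) (le_of_eq (by ring)) G.ineq126 G.volBound (G.ineq227 X₀)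
    hrate h4 (G.cubes_nonempty X₀) hhol hm hL3

/-- **THE ATTACHED PART UNDER THE TWICE-UNDRESSED-PLUS-TWICE-ATTACHED CLAUSE, OVER A POLYMER GEOMETRY — EVERY LIVE SLOPE** (kernel;
N0m §2 `attachedPart_locE_le` BY NAME at `ϱ⋆ = max 2 (A₀/A₁)`, its `hϱ` ∕ `hϱA` ∕ `hsmall` supplied by N0m v1.1's `two_le_pencilRadius` ∕
`intercept_le_pencilRadius_mul` ∕ `pencilClause_of_two_two` BY NAME; geometry fed from `G`): ANY live slope `0 < A₁`, clause
`h22 : (2·A₀ + 2·A₁)·(e^{5r₁+1}·G.K₀·G.ν·G.c₁) ≤ 1` (the companion the v1.1 docstring names) ⇒ the same conclusion. [folklore] -/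
theorem attachedPart_locE_le_of_twoTwoClause_of_geometry {m : D.Dom → ℝ} {act : ℂ → D.Dom → ℂ} {A₀ A₁ R r₁ : ℝ}
    (X₀ : D.Dom) (hA₀ : 0 ≤ A₀) (hA₁ : 0 < A₁) (hr₁ : 0 ≤ r₁) (hrate : r₁ + 2 * G.κ₀ + 2 ≤ R)
    (h22 : (2 * A₀ + 2 * A₁) * (Real.exp (5 * r₁ + 1) * G.K₀ * G.ν * G.c₁) ≤ 1)
    (hhol : ∀ Z, G.cubes Z ⊆ G.cubes X₀ → DifferentiableOn ℂ (fun s => act s Z) (ball (0 : ℂ) (max 2 (A₀ / A₁))))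
    (hm : ∀ s ∈ ball (0 : ℂ) (max 2 (A₀ / A₁)), ∀ Z, G.cubes Z ⊆ G.cubes X₀ → ‖act s Z‖ ≤ m Z)
    (hL3 : ∀ Z, G.cubes Z ⊆ G.cubes X₀ → m Z ≤ (A₀ + max 2 (A₀ / A₁) * A₁) * Real.exp (-(R * D.dj Z))) :
    ‖locE G.ι G.cubes (act 1) (G.cubes X₀) - locE G.ι G.cubes (act 0) (G.cubes X₀)‖ ≤
      4 * (Real.exp 1 * G.ν * G.c₁ * G.K₀ ^ 2) * A₁ * Real.exp (-(r₁ * D.dj X₀)) := by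
  have hE : 0 ≤ Real.exp (5 * r₁ + 1) * G.K₀ * G.ν * G.c₁ :=
    mul_nonneg (mul_nonneg (mul_nonneg (Real.exp_nonneg _) G.K₀_nonneg) G.ν_nonneg) G.c₁_nonneg
  have hsmall' := pencilClause_of_two_two hA₀ hA₁ hE h22
  have hsmall : (A₀ + max 2 (A₀ / A₁) * A₁) * Real.exp (5 * r₁ + 1) * G.K₀ * G.ν * G.c₁ ≤ 1 := by
    simpa only [mul_assoc] using hsmall'
  haveI : Std.Refl G.ι := ⟨G.ι_refl⟩
  haveI : Std.Symm G.ι := ⟨G.ι_symm⟩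
  exact attachedPart_locE_le G.ι (c := 5) (b := 5 * r₁) G.loc G.reach_le D.dj_nonneg hA₀ hA₁.le G.K₀_nonneg G.c₁_nonneg
    G.ν_nonneg G.κ₀_nonneg hr₁ (by norm_num) (le_of_eq (by ring)) G.ineq126 G.volBound (G.ineq227 X₀) hrate hsmall
    (G.cubes_nonempty X₀) hhol hm hL3 (two_le_pencilRadius A₀ A₁) (intercept_le_pencilRadius_mul hA₁)

end OfGeometry
/-! ## §2 ON THE TORUS OF THE PAPERS — no geometry hypothesis, no radius binder; (B5) located as numerals (S24 ∕ S25 §2 pattern) -/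
section Torus
variable {N : ℕ} [NeZero N]

open Classical in
/-- **THE ϱ-FREE INDUCTION END ON THE TORUS — NO GEOMETRY HYPOTHESIS** (kernel; §1 at `tgeometry 4 N`, constants located by N0o
`torus_consts` + S24 `K₀_four`): live slope `0 < A₁ ≤ A₀`, «κ large» `r₁ + 2·(64·log 162) + 2 ≤ R`, «ε₁ small with a factor-4 room»
`4·A₀·(e^{5r₁+1}·K₀(64,8)·9·64) ≤ 1` ⇒ on a scale-(k+1) torus domain `X₀` the attached part is
`≤ 4·(e·9·64·K₀(64,8)²)·A₁·e^{−r₁·torusTreeLen X₀}` — LITERALLY S25's `attachedPart_locE_le_torus` right-hand side — modulo ONLY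
(E1)∕(E2) on `ball 0 ϱ⋆`, (B3) `hL3`, the clauses. [folklore] -/
theorem attachedPart_locE_le_of_printClause_four_torus {m : (tsys 4 N).Dom → ℝ} {act : ℂ → (tsys 4 N).Dom → ℂ} {A₀ A₁ R r₁ : ℝ}
    (X₀ : (tsys 4 N).Dom) (hA₀ : 0 ≤ A₀) (hA₁ : 0 < A₁) (hle : A₁ ≤ A₀) (hr₁ : 0 ≤ r₁) (hrate : r₁ + 2 * (64 * Real.log 162) + 2 ≤ R)
    (h4 : 4 * A₀ * (Real.exp (5 * r₁ + 1) * K₀ 64 8 * 9 * 64) ≤ 1)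
    (hhol : ∀ Z : (tsys 4 N).Dom, Z.1 ⊆ X₀.1 → DifferentiableOn ℂ (fun s => act s Z) (ball (0 : ℂ) (max 2 (A₀ / A₁))))
    (hm : ∀ s ∈ ball (0 : ℂ) (max 2 (A₀ / A₁)), ∀ Z : (tsys 4 N).Dom, Z.1 ⊆ X₀.1 → ‖act s Z‖ ≤ m Z)
    (hL3 : ∀ Z : (tsys 4 N).Dom, Z.1 ⊆ X₀.1 → m Z ≤ (A₀ + max 2 (A₀ / A₁) * A₁) * Real.exp (-(R * torusTreeLen Z.1))) :
    ‖locE (TTouch (d := 4) (N := N)) (fun Z : (tsys 4 N).Dom => Z.1) (act 1) X₀.1 -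
        locE (TTouch (d := 4) (N := N)) (fun Z : (tsys 4 N).Dom => Z.1) (act 0) X₀.1‖ ≤
      4 * (Real.exp 1 * 9 * 64 * K₀ 64 8 ^ 2) * A₁ * Real.exp (-(r₁ * torusTreeLen X₀.1)) := by
  obtain ⟨hν, hκ, hc⟩ := torus_consts N
  have hK := K₀_four (N := N)
  have h := attachedPart_locE_le_of_printClause_four_of_geometry (tgeometry 4 N) (m := m) (act := act) (R := R) X₀ hA₀ hA₁ hle hr₁
    (by rw [hκ]; exact hrate) (by rw [hK, hν, hc]; exact h4) hhol hm hL3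
  rw [hν, hc, hK] at h
  exact h

open Classical in
/-- **THE TWICE-TWO COMPANION ON THE TORUS — NO GEOMETRY HYPOTHESIS, EVERY LIVE SLOPE** (kernel; §1 at `tgeometry 4 N`, constants
located): ANY `0 < A₁`, `r₁ + 2·(64·log 162) + 2 ≤ R`, `(2·A₀ + 2·A₁)·(e^{5r₁+1}·K₀(64,8)·9·64) ≤ 1` ⇒ the same bound. [folklore] -/
theorem attachedPart_locE_le_of_twoTwoClause_torus {m : (tsys 4 N).Dom → ℝ} {act : ℂ → (tsys 4 N).Dom → ℂ} {A₀ A₁ R r₁ : ℝ}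
    (X₀ : (tsys 4 N).Dom) (hA₀ : 0 ≤ A₀) (hA₁ : 0 < A₁) (hr₁ : 0 ≤ r₁) (hrate : r₁ + 2 * (64 * Real.log 162) + 2 ≤ R)
    (h22 : (2 * A₀ + 2 * A₁) * (Real.exp (5 * r₁ + 1) * K₀ 64 8 * 9 * 64) ≤ 1)
    (hhol : ∀ Z : (tsys 4 N).Dom, Z.1 ⊆ X₀.1 → DifferentiableOn ℂ (fun s => act s Z) (ball (0 : ℂ) (max 2 (A₀ / A₁))))
    (hm : ∀ s ∈ ball (0 : ℂ) (max 2 (A₀ / A₁)), ∀ Z : (tsys 4 N).Dom, Z.1 ⊆ X₀.1 → ‖act s Z‖ ≤ m Z)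
    (hL3 : ∀ Z : (tsys 4 N).Dom, Z.1 ⊆ X₀.1 → m Z ≤ (A₀ + max 2 (A₀ / A₁) * A₁) * Real.exp (-(R * torusTreeLen Z.1))) :
    ‖locE (TTouch (d := 4) (N := N)) (fun Z : (tsys 4 N).Dom => Z.1) (act 1) X₀.1 -
        locE (TTouch (d := 4) (N := N)) (fun Z : (tsys 4 N).Dom => Z.1) (act 0) X₀.1‖ ≤
      4 * (Real.exp 1 * 9 * 64 * K₀ 64 8 ^ 2) * A₁ * Real.exp (-(r₁ * torusTreeLen X₀.1)) := by
  obtain ⟨hν, hκ, hc⟩ := torus_consts N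
  have hK := K₀_four (N := N)
  have h := attachedPart_locE_le_of_twoTwoClause_of_geometry (tgeometry 4 N) (m := m) (act := act) (R := R) X₀ hA₀ hA₁
    hr₁ (by rw [hκ]; exact hrate) (by rw [hK, hν, hc]; exact h22) hhol hm hL3
  rw [hν, hc, hK] at h
  exact h

/-! ## §3 Consistency — one currency, in kernel -/
open Classical in
/-- (E1) Under `A₁ ≤ A₀` the print-clause torus face FOLLOWS from the twice-two torus face (`4·A₀·E ≤ 1 ⇒ (2·A₀ + 2·A₁)·E ≤ 1` for
`0 ≤ E` — linear arithmetic): the two §2 faces are one statement on the print-clause range. [folklore] -/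
example {m : (tsys 4 N).Dom → ℝ} {act : ℂ → (tsys 4 N).Dom → ℂ} {A₀ A₁ R r₁ : ℝ} (X₀ : (tsys 4 N).Dom)
    (hA₀ : 0 ≤ A₀) (hA₁ : 0 < A₁) (hle : A₁ ≤ A₀) (hr₁ : 0 ≤ r₁) (hrate : r₁ + 2 * (64 * Real.log 162) + 2 ≤ R)
    (h4 : 4 * A₀ * (Real.exp (5 * r₁ + 1) * K₀ 64 8 * 9 * 64) ≤ 1)
    (hhol : ∀ Z : (tsys 4 N).Dom, Z.1 ⊆ X₀.1 → DifferentiableOn ℂ (fun s => act s Z) (ball (0 : ℂ) (max 2 (A₀ / A₁))))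
    (hm : ∀ s ∈ ball (0 : ℂ) (max 2 (A₀ / A₁)), ∀ Z : (tsys 4 N).Dom, Z.1 ⊆ X₀.1 → ‖act s Z‖ ≤ m Z)
    (hL3 : ∀ Z : (tsys 4 N).Dom, Z.1 ⊆ X₀.1 → m Z ≤ (A₀ + max 2 (A₀ / A₁) * A₁) * Real.exp (-(R * torusTreeLen Z.1))) :
    ‖locE (TTouch (d := 4) (N := N)) (fun Z : (tsys 4 N).Dom => Z.1) (act 1) X₀.1 -
        locE (TTouch (d := 4) (N := N)) (fun Z : (tsys 4 N).Dom => Z.1) (act 0) X₀.1‖ ≤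
      4 * (Real.exp 1 * 9 * 64 * K₀ 64 8 ^ 2) * A₁ * Real.exp (-(r₁ * torusTreeLen X₀.1)) := by
  have hKp : 0 < K₀ 64 8 := K₀_pos 64 8
  have hE : 0 ≤ Real.exp (5 * r₁ + 1) * K₀ 64 8 * 9 * 64 := by positivity
  exact attachedPart_locE_le_of_twoTwoClause_torus X₀ hA₀ hA₁ hr₁ hrate (by nlinarith) hhol hm hL3

open Classical in
/-- (E2) The print-clause torus face IS the S24 ∕ S25 pattern — N0o `attachedPart_locE_le_geom` at `ϱ⋆ = max 2 (A₀/A₁)` on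
`tgeometry 4 N` — with `hϱ` ∕ `hϱA` ∕ `hsmall` from N0m v1.1's §4 arithmetic BY NAME: S26 asserts no new inequality. [folklore] -/
example {m : (tsys 4 N).Dom → ℝ} {act : ℂ → (tsys 4 N).Dom → ℂ} {A₀ A₁ R r₁ : ℝ} (X₀ : (tsys 4 N).Dom)
    (hA₀ : 0 ≤ A₀) (hA₁ : 0 < A₁) (hle : A₁ ≤ A₀) (hr₁ : 0 ≤ r₁) (hrate : r₁ + 2 * (64 * Real.log 162) + 2 ≤ R)
    (h4 : 4 * A₀ * (Real.exp (5 * r₁ + 1) * K₀ 64 8 * 9 * 64) ≤ 1)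
    (hhol : ∀ Z : (tsys 4 N).Dom, Z.1 ⊆ X₀.1 → DifferentiableOn ℂ (fun s => act s Z) (ball (0 : ℂ) (max 2 (A₀ / A₁))))
    (hm : ∀ s ∈ ball (0 : ℂ) (max 2 (A₀ / A₁)), ∀ Z : (tsys 4 N).Dom, Z.1 ⊆ X₀.1 → ‖act s Z‖ ≤ m Z)
    (hL3 : ∀ Z : (tsys 4 N).Dom, Z.1 ⊆ X₀.1 → m Z ≤ (A₀ + max 2 (A₀ / A₁) * A₁) * Real.exp (-(R * torusTreeLen Z.1))) :
    ‖locE (TTouch (d := 4) (N := N)) (fun Z : (tsys 4 N).Dom => Z.1) (act 1) X₀.1 -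
        locE (TTouch (d := 4) (N := N)) (fun Z : (tsys 4 N).Dom => Z.1) (act 0) X₀.1‖ ≤
      4 * (Real.exp 1 * 9 * 64 * K₀ 64 8 ^ 2) * A₁ * Real.exp (-(r₁ * torusTreeLen X₀.1)) := by
  obtain ⟨hν, hκ, hc⟩ := torus_consts N
  have hK := K₀_four (N := N)
  have hKp : 0 < K₀ 64 8 := K₀_pos 64 8
  have hE : 0 ≤ Real.exp (5 * r₁ + 1) * K₀ 64 8 * 9 * 64 := by positivity
  have hsmall' := pencilClause_of_printClause_four hA₀ hA₁ hle hE h4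
  have hsmall : (A₀ + max 2 (A₀ / A₁) * A₁) * Real.exp (5 * r₁ + 1) * (tgeometry 4 N).K₀ * (tgeometry 4 N).ν *
      (tgeometry 4 N).c₁ ≤ 1 := by
    rw [hK, hν, hc]; simpa only [mul_assoc] using hsmall'
  have h := attachedPart_locE_le_geom (tsys 4 N) (tgeometry 4 N) (m := m) (act := act) (R := R) (b := 5 * r₁) (X₀ := X₀)
    hA₀ hA₁.le hr₁ (le_of_eq (by ring)) (by rw [hκ]; exact hrate) hsmall hhol hm hL3 (two_le_pencilRadius A₀ A₁)
    (intercept_le_pencilRadius_mul hA₁)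
  rw [hν, hc, hK] at h
  exact h
end Torus

/-! ## §4 (v1.1) THE SHARP-ROOM-3 INDUCTION END OVER A `Geometry` BUNDLE AND ON THE TORUS — N0m v1.2's
`attachedPart_locE_le_of_printClause_three` (p224750) wired by the §1 ∕ §2 pattern verbatim: `h4 ↦ h3 : 3·A₀·E ≤ 1` (the room 3 is
ATTAINED at `A₁ = A₀`, ϱ⋆ = 2 — `pencilConst_le_three`); every other binder, and the conclusion, as in the factor-4 faces -/
section SharpRoom
open Summit.QuantumFields.BalabanUV.T4Continuum.NE1p.DressedSmallFieldInduction (attachedPart_locE_le_of_printClause_three)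
variable {D : LocDomainSys} {Cube : Type} [DecidableEq Cube] [DecidableEq D.Dom] (G : Geometry D Cube) [DecidableRel G.ι]

/-- **THE ATTACHED PART UNDER PRINT'S CLAUSE WITH THE SHARP FACTOR-3 ROOM, OVER A POLYMER GEOMETRY** (kernel; N0m v1.2
`attachedPart_locE_le_of_printClause_three` BY NAME, geometry ∕ sign sockets fed from `G` at the footprint `G.cubes X₀`, `c = 5`,
`b = 5·r₁`): live slope `0 < A₁ ≤ A₀`, «κ large» `hrate`, «ε₁ small at the undressed constant with a factor-3 room»
`h3 : 3·A₀·(e^{5r₁+1}·G.K₀·G.ν·G.c₁) ≤ 1`, (E1)∕(E2) on the ball of radius `ϱ⋆ = max 2 (A₀/A₁)`, AFFINE (2.38)-majorant `hL3` (a BINDER =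
(B3)) ⇒ `≤ 4·(e·G.ν·G.c₁·G.K₀²)·A₁·e^{−r₁ d(X₀)}` — §1's factor-4 face with `h4 ↦ h3`, nothing else moved. [folklore] -/
theorem attachedPart_locE_le_of_printClause_three_of_geometry {m : D.Dom → ℝ} {act : ℂ → D.Dom → ℂ} {A₀ A₁ R r₁ : ℝ}
    (X₀ : D.Dom) (hA₀ : 0 ≤ A₀) (hA₁ : 0 < A₁) (hle : A₁ ≤ A₀) (hr₁ : 0 ≤ r₁) (hrate : r₁ + 2 * G.κ₀ + 2 ≤ R)
    (h3 : 3 * A₀ * (Real.exp (5 * r₁ + 1) * G.K₀ * G.ν * G.c₁) ≤ 1)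
    (hhol : ∀ Z, G.cubes Z ⊆ G.cubes X₀ → DifferentiableOn ℂ (fun s => act s Z) (ball (0 : ℂ) (max 2 (A₀ / A₁))))
    (hm : ∀ s ∈ ball (0 : ℂ) (max 2 (A₀ / A₁)), ∀ Z, G.cubes Z ⊆ G.cubes X₀ → ‖act s Z‖ ≤ m Z)
    (hL3 : ∀ Z, G.cubes Z ⊆ G.cubes X₀ → m Z ≤ (A₀ + max 2 (A₀ / A₁) * A₁) * Real.exp (-(R * D.dj Z))) :
    ‖locE G.ι G.cubes (act 1) (G.cubes X₀) - locE G.ι G.cubes (act 0) (G.cubes X₀)‖ ≤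
      4 * (Real.exp 1 * G.ν * G.c₁ * G.K₀ ^ 2) * A₁ * Real.exp (-(r₁ * D.dj X₀)) := by
  haveI : Std.Refl G.ι := ⟨G.ι_refl⟩
  haveI : Std.Symm G.ι := ⟨G.ι_symm⟩
  exact attachedPart_locE_le_of_printClause_three G.ι (c := 5) (b := 5 * r₁) G.loc G.reach_le D.dj_nonneg hA₀ hA₁ hle
    G.K₀_nonneg G.c₁_nonneg G.ν_nonneg G.κ₀_nonneg hr₁ (by norm_num) (le_of_eq (by ring)) G.ineq126 G.volBound (G.ineq227 X₀)
    hrate h3 (G.cubes_nonempty X₀) hhol hm hL3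

end SharpRoom
section SharpRoomTorus
variable {N : ℕ} [NeZero N]

open Classical in
/-- **THE SHARP-ROOM-3 INDUCTION END ON THE TORUS — NO GEOMETRY HYPOTHESIS** (kernel; §4's `Geometry` face at `tgeometry 4 N`,
constants located by N0o `torus_consts` + S24 `K₀_four`): live slope `0 < A₁ ≤ A₀`, «κ large» `r₁ + 2·(64·log 162) + 2 ≤ R`, «ε₁ small
with the SHARP factor-3 room» `3·A₀·(e^{5r₁+1}·K₀(64,8)·9·64) ≤ 1` ⇒ on a scale-(k+1) torus domain `X₀` the attached part is
`≤ 4·(e·9·64·K₀(64,8)²)·A₁·e^{−r₁·torusTreeLen X₀}` — LITERALLY §2's right-hand side — modulo ONLY (E1)∕(E2) on `ball 0 ϱ⋆`, (B3)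
`hL3`, the clauses.  The factor `3` and the clause SHAPE are the owner's v1.2 arithmetic BY NAME; no numeral of print. [folklore] -/
theorem attachedPart_locE_le_of_printClause_three_torus {m : (tsys 4 N).Dom → ℝ} {act : ℂ → (tsys 4 N).Dom → ℂ} {A₀ A₁ R r₁ : ℝ}
    (X₀ : (tsys 4 N).Dom) (hA₀ : 0 ≤ A₀) (hA₁ : 0 < A₁) (hle : A₁ ≤ A₀) (hr₁ : 0 ≤ r₁) (hrate : r₁ + 2 * (64 * Real.log 162) + 2 ≤ R)
    (h3 : 3 * A₀ * (Real.exp (5 * r₁ + 1) * K₀ 64 8 * 9 * 64) ≤ 1)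
    (hhol : ∀ Z : (tsys 4 N).Dom, Z.1 ⊆ X₀.1 → DifferentiableOn ℂ (fun s => act s Z) (ball (0 : ℂ) (max 2 (A₀ / A₁))))
    (hm : ∀ s ∈ ball (0 : ℂ) (max 2 (A₀ / A₁)), ∀ Z : (tsys 4 N).Dom, Z.1 ⊆ X₀.1 → ‖act s Z‖ ≤ m Z)
    (hL3 : ∀ Z : (tsys 4 N).Dom, Z.1 ⊆ X₀.1 → m Z ≤ (A₀ + max 2 (A₀ / A₁) * A₁) * Real.exp (-(R * torusTreeLen Z.1))) :
    ‖locE (TTouch (d := 4) (N := N)) (fun Z : (tsys 4 N).Dom => Z.1) (act 1) X₀.1 -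
        locE (TTouch (d := 4) (N := N)) (fun Z : (tsys 4 N).Dom => Z.1) (act 0) X₀.1‖ ≤
      4 * (Real.exp 1 * 9 * 64 * K₀ 64 8 ^ 2) * A₁ * Real.exp (-(r₁ * torusTreeLen X₀.1)) := by
  obtain ⟨hν, hκ, hc⟩ := torus_consts N
  have hK := K₀_four (N := N)
  have h := attachedPart_locE_le_of_printClause_three_of_geometry (tgeometry 4 N) (m := m) (act := act) (R := R) X₀ hA₀ hA₁ hle
    hr₁ (by rw [hκ]; exact hrate) (by rw [hK, hν, hc]; exact h3) hhol hm hL3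
  rw [hν, hc, hK] at h
  exact h

open Classical in
/-- (E3) ONE CURRENCY, IN KERNEL: under the factor-4 clause the v1 §2 print-clause torus face FOLLOWS from the sharp factor-3 torus
face (`4·A₀·E ≤ 1 ⇒ 3·A₀·E ≤ 1` for `0 ≤ A₀`, `0 ≤ E` — linear arithmetic); the statement below is §2's
`attachedPart_locE_le_of_printClause_four_torus` VERBATIM.  S26 v1.1 asserts no new inequality. [folklore] -/
example {m : (tsys 4 N).Dom → ℝ} {act : ℂ → (tsys 4 N).Dom → ℂ} {A₀ A₁ R r₁ : ℝ} (X₀ : (tsys 4 N).Dom)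
    (hA₀ : 0 ≤ A₀) (hA₁ : 0 < A₁) (hle : A₁ ≤ A₀) (hr₁ : 0 ≤ r₁) (hrate : r₁ + 2 * (64 * Real.log 162) + 2 ≤ R)
    (h4 : 4 * A₀ * (Real.exp (5 * r₁ + 1) * K₀ 64 8 * 9 * 64) ≤ 1)
    (hhol : ∀ Z : (tsys 4 N).Dom, Z.1 ⊆ X₀.1 → DifferentiableOn ℂ (fun s => act s Z) (ball (0 : ℂ) (max 2 (A₀ / A₁))))
    (hm : ∀ s ∈ ball (0 : ℂ) (max 2 (A₀ / A₁)), ∀ Z : (tsys 4 N).Dom, Z.1 ⊆ X₀.1 → ‖act s Z‖ ≤ m Z)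
    (hL3 : ∀ Z : (tsys 4 N).Dom, Z.1 ⊆ X₀.1 → m Z ≤ (A₀ + max 2 (A₀ / A₁) * A₁) * Real.exp (-(R * torusTreeLen Z.1))) :
    ‖locE (TTouch (d := 4) (N := N)) (fun Z : (tsys 4 N).Dom => Z.1) (act 1) X₀.1 -
        locE (TTouch (d := 4) (N := N)) (fun Z : (tsys 4 N).Dom => Z.1) (act 0) X₀.1‖ ≤
      4 * (Real.exp 1 * 9 * 64 * K₀ 64 8 ^ 2) * A₁ * Real.exp (-(r₁ * torusTreeLen X₀.1)) := by
  have hKp : 0 < K₀ 64 8 := K₀_pos 64 8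
  have hE : 0 ≤ Real.exp (5 * r₁ + 1) * K₀ 64 8 * 9 * 64 := by positivity
  have hAE : 0 ≤ A₀ * (Real.exp (5 * r₁ + 1) * K₀ 64 8 * 9 * 64) := mul_nonneg hA₀ hE
  exact attachedPart_locE_le_of_printClause_three_torus X₀ hA₀ hA₁ hle hr₁ hrate (by nlinarith) hhol hm hL3
end SharpRoomTorus
end Summit.QuantumFields.BalabanUV.T4Continuum.NE1p.DressedSmallFieldInductionFaces
end
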